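import Mathlib

/-!
# The pencil lemma behind the saturation certificates of ENGINE v17 'PENT2X'
(HodgeConjecture / FermatCycles cell, ftc-engine gen-21)

HONEST FRAMING: explicit algebraic cycles for specific Hodge classes on Fermat/Delsarte varieties;
residual open instances listed; no claim on general Hodge.

`code/ftc/pent2x/zcert.py` (memo `ftc/certs/W69/PENT2X.md` §3) certifies that a closed set
`Z ⊆ ℙ³` cut out by cubics consists of given lines `ℓ₁, …, ℓ_r` and finitely many further points by
computing the saturations `(I : g_λ^∞)` for `λ = 0, …, r`, where `g_λ = ∏ᵢ (aᵢ + λ • bᵢ)` and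
`(aᵢ, bᵢ)` generate the ideal of `ℓᵢ`.  The covering property used is elementary: a point `q` off
every line has `(aᵢ(q), bᵢ(q)) ≠ (0, 0)` for every `i`, each `i` kills at most one value of `λ`,
so among any `r + 1` distinct values some `g_λ` does not vanish at `q`.  This file records exactly
that statement over a field; nothing else of the engine is formalised here.
-/

namespace Summit.HodgeConjecture.FermatCycles.SaturationPencil

open Finset

/-- For each index `i`, an affine-linear function `λ ↦ aᵢ + λ bᵢ` with `(aᵢ, bᵢ) ≠ (0, 0)` has at
most one zero inside any finite set `S`. -/
theorem card_filter_root_le_one {K : Type*} [Field K] [DecidableEq K]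
    (a b : K) (h : a ≠ 0 ∨ b ≠ 0) (S : Finset K) :
    (S.filter (fun l => a + l * b = 0)).card ≤ 1 := by
  rw [Finset.card_le_one]
  intro x hx y hy
  simp only [Finset.mem_filter] at hx hy
  have hb : b ≠ 0 := by
    rcases h with ha | hb
    · intro hb
      apply ha
      simpa [hb] using hx.2
    · exact hb
  have hxy : (x - y) * b = 0 := by linear_combination hx.2 - hy.2
  rcases mul_eq_zero.mp hxy with h1 | h1
  · exact sub_eq_zero.mp h1
  · exact absurd h1 hb

/-- The pencil lemma: if `(aᵢ, bᵢ) ≠ (0, 0)` for every `i < r` and `S` has more than `r`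
elements, some `λ ∈ S` makes `∏ᵢ (aᵢ + λ bᵢ)` non-zero. -/
theorem exists_prod_ne_zero {K : Type*} [Field K] [DecidableEq K] {r : ℕ}
    (a b : Fin r → K) (h : ∀ i, a i ≠ 0 ∨ b i ≠ 0) (S : Finset K) (hS : r < S.card) :
    ∃ l ∈ S, ∏ i, (a i + l * b i) ≠ 0 := by
  classical
  set bad : Finset K := Finset.univ.biUnion (fun i : Fin r => S.filter (fun l => a i + l * b i = 0))
    with hbad_def
  have hbad : bad.card ≤ r := by
    calc bad.card ≤ ∑ i : Fin r, (S.filter (fun l => a i + l * b i = 0)).card :=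
          Finset.card_biUnion_le
      _ ≤ ∑ _i : Fin r, 1 := Finset.sum_le_sum (fun i _ => card_filter_root_le_one (a i) (b i) (h i) S)
      _ = r := by simp
  have hsub : bad ⊆ S := by
    intro l hl
    rw [hbad_def, Finset.mem_biUnion] at hl
    obtain ⟨i, -, hi⟩ := hl
    exact (Finset.mem_filter.mp hi).1
  have hne : (S \ bad).Nonempty := by
    rw [← Finset.card_pos, Finset.card_sdiff, Finset.inter_eq_left.mpr hsub]
    omega
  obtain ⟨l, hl⟩ := hne
  rw [Finset.mem_sdiff] at hl
  refine ⟨l, hl.1, ?_⟩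
  rw [Finset.prod_ne_zero_iff]
  intro i _ hzero
  apply hl.2
  rw [hbad_def, Finset.mem_biUnion]
  exact ⟨i, Finset.mem_univ i, Finset.mem_filter.mpr ⟨hl.1, hzero⟩⟩

/-- The instance used by the engine: `S = {0, 1, …, r}` as elements of a field in which these
`r + 1` naturals are distinct (e.g. `𝔽_p` with `p > r`). -/
theorem exists_prod_ne_zero_range {K : Type*} [Field K] [DecidableEq K] {r : ℕ}
    (a b : Fin r → K) (h : ∀ i, a i ≠ 0 ∨ b i ≠ 0)
    (hinj : Set.InjOn (fun n : ℕ => (n : K)) (Set.Iio (r + 1))) :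
    ∃ n : ℕ, n ≤ r ∧ ∏ i, (a i + (n : K) * b i) ≠ 0 := by
  classical
  let S : Finset K := (Finset.range (r + 1)).image (fun n : ℕ => (n : K))
  have hS : r < S.card := by
    have : S.card = r + 1 := by
      rw [Finset.card_image_of_injOn]
      · simp
      · intro x hx y hy hxy
        exact hinj (by simpa using hx) (by simpa using hy) hxy
    omega
  obtain ⟨l, hl, hprod⟩ := exists_prod_ne_zero a b h S hS
  obtain ⟨n, hn, rfl⟩ := Finset.mem_image.mp hl
  exact ⟨n, by simpa [Nat.lt_succ_iff] using hn, hprod⟩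

end Summit.HodgeConjecture.FermatCycles.SaturationPencil
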